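import Mathlib.Analysis.Real.Pi.Bounds
import Mathlib.Analysis.Calculus.Deriv.MeanValue
import Literature.NumberTheory.LFunctions.MontgomeryTheoremTestFunctions
import Literature.NumberTheory.LFunctions.AlternativeHypothesisCorollary4Proofs
import Literature.NumberTheory.LFunctions.PairCorrelationSmallGaps
import Literature.NumberTheory.LFunctions.ZetaGapRecordsRH
import HarnessLib

/-!
# Montgomery 1973, Corollary 3: on RH, `lim inf (γ_{n+1} − γ_n)(log γ_n/2π) ≤ 0.68` — proof

Topic `Literature/NumberTheory/LFunctions` (namespace `Literature.NumberTheory.LFunctions`). PROOF LAYER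
(cell `rh-crit/ah`, C5, seat t1): theorems only, no definitions, no named facts. It DISCHARGES the named fact
`Literature.NumberTheory.LFunctions.montgomery1973_corollary3` of `ZetaGapRecordsRH.lean`
(`RiemannHypothesis → ZetaGapLiminfLe 0.68`) as `Literature.NumberTheory.LFunctions.montgomery1973_corollary3_holds`.
LABEL: **NOT RH-BEARING** — RH is the printed ANTECEDENT of Corollary 3 ("Assume RH."); a 1973
RH-conditional record re-proved in the kernel from the tree's Montgomery theorem; nothing here bears on the
truth of RH.

## What the source prints

H. L. Montgomery, *The pair correlation of zeros of the zeta function*, Proc. Sympos. Pure Math. 24 (1973),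
181–193 (read in the reprint in Borwein–Choi–Rooney–Weirathmueller, *The Riemann Hypothesis: A Resource …*,
Springer 2008, internal scan; §1 pp. 181–183, §4 "The corollaries").

* §1, (3): "`∑_{0<γ≤T, 0<γ'≤T} r((γ − γ') log T/2π) w(γ − γ') = ((T/2π) log T) ∫_{−∞}^{+∞} F(α) r̂(α) dα`."
* §1, COROLLARY 3: "(Assume RH.) We can compute a constant `λ` so that
  (8) `lim inf_{n→∞} (γ_{n+1} − γ_n)(log γ_n/2π) ≤ λ < 1`. … We note that if `ζ(s)` has infinitely many
  multiple zeros then we may take `λ = 0` in (8). Our proof allows us to take `λ = 0.68`."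
* §4: "We now turn to the first assertion of Corollary 3. We take `r(u) = max(1 − (|u|/λ), 0)` in (3), and
  choose `λ` later. Now `r̂(α)` is nonnegative, and `∫_0^∞ r̂(α) dα < ∞`, so our Theorem permits us to
  calculate a lower bound for the right-hand side of (3). We see that
  `∫ F(α) r̂(α) dα ≥ (1 + o(1))(λ + 2λ ∫_0^1 α (sin πλα/πλα)² dα)(T/2π) log T`. We may assume that all but
  finitely many zeros are simple, so the terms `γ = γ'` in (3) contribute an amount `∼ (T/2π) log T`. Hence
  `∑_{0<γ,γ'≤T, 0<γ−γ'<2πλ/log T} 1 ≥ (½ + o(1)) C(λ) (T/2π) log T` where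
  `C(λ) = λ + (1/π²λ) Cin(2πλ) − 1` … To obtain (8) we show that `C(λ) > 0` for some `λ < 1`. … In fact
  a little calculation reveals that `C(0.68) > 0`."

## The proof as formalised (the printed road; every input is a tree theorem)

We run the argument with the normalised pair `g(α) = (sin πλα/πλα)²` (`= r̂/λ`), whose Fourier transform is
`ĝ(u) = λ⁻² max(λ − |u|, 0) = r(u)/λ` — the tree's `AH.fejerTest λ 0` (`fourier_sinc_sq`,
`AlternativeHypothesisCorollary4Proofs.lean`).

* (3) — `sum_fejerTest_pairSpacing_eq`: `∑_{p} ĝ(((γ_i − γ_j)/2π) log T) w(γ_i − γ_j) = ((T/2π) log T) ∫_ℝ F(α, T) g(α) dα`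
  (tree `AH.sum_fourier_pairSpacing_eq_integral`, unconditional).
* Lower bound: `F ≥ 0` on all of `ℝ` (tree `Montgomery.montgomeryFormFactor_nonneg`, exact and without RH)
  and `g ≥ 0` give `∫_ℝ F g ≥ ∫_{−1}^{1} F g`, and by Montgomery's theorem against test functions on
  `[−1, 1]` (tree `Montgomery.tendsto_integral_formFactor_mul_of_subset_Icc`, the Goldston–Montgomery form of
  the Theorem, under RH) `∫_{−1}^{1} F g → g(0) + ∫_{−1}^{1} |α| g(α) dα = 1 + 2∫_0^1 α (sin πλα/πλα)² dα`
  — the printed display divided by `λ`.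
* Upper bound: `0 ≤ ĝ ≤ λ⁻¹ 𝟙_{|u|<λ}` and `0 < w ≤ 1`, so the pair sum is at most `λ⁻¹` times the number of
  index pairs with `|γ_i − γ_j| (log T)/2π < λ`.
* "We may assume that all but finitely many zeros are simple" — OURS (bookkeeping gloss, not a quotation):
  we argue by contradiction from "`δ_n = (γ_{n+1} − γ_n) log γ_n/2π ≥ λ` for all `n ≥ M`" (the negation of
  the conclusion "`δ_n < λ` infinitely often"), which covers the source's remark "if `ζ(s)` has infinitely
  many multiple zeros then we may take `λ = 0`" (there `δ_n = 0` infinitely often) in the same stroke. It forces `γ_n < γ_{n+1}` for `n ≥ M`, and then every index pair with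
  `|γ_i − γ_j| log T/2π < λ` is either diagonal (`i = j`: `N(T)` of them) or has both indices `≤ M`
  (`close_pairs_subset`), so the pair sum is `≤ λ⁻¹ (N(T) + (M+1)²)`; with `N(T) ∼ (T/2π) log T`
  (tree `RudnickSarnak.tendsto_zetaZeroCount_div_main`, Riemann–von Mangoldt) this contradicts the lower
  bound as soon as `C(λ)/λ = (1 + 2∫_0^1 α (sin πλα/πλα)² dα) − 1/λ > 0` (`frequently_zetaNormalizedGap_lt`:
  Montgomery's criterion "`C(λ) > 0` gives (8) with this `λ`").
* "A little calculation reveals that `C(0.68) > 0`" — `criterion_068`: `2∫_0^1 α sinc²(0.68πα) dα > 25/17 − 1`,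
  from the global Taylor bound `cos u ≤ 1 − u²/2! + u⁴/4! − u⁶/6! + u⁸/8!` (hence
  `sin² x ≥ x² − x⁴/3 + 2x⁶/45 − x⁸/315`) integrated exactly, and Mathlib's `3.141592 < π < 3.141593`
  (`Real.pi_gt_d6`, `Real.pi_lt_d6`); the margin is `≈ 1.9·10⁻³` on `8/17`.
* Assembly: `δ_n < 0.68` infinitely often, hence `μ ≤ 0.68` (`zetaGapLiminfLe_of_frequently_lt`,
  `ZetaGapRecordsRH.lean`): `montgomery1973_corollary3_holds`.

## References

* [Montgomery1973] H. L. Montgomery, *The pair correlation of zeros of the zeta function*, Proc. Sympos. Pure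
  Math. 24, AMS (1973), 181–193: §1 (3), Corollary 3 with (8); §4 (proof of Corollary 3, `C(0.68) > 0`).
* [GoldstonMontgomery1987] D. A. Goldston, H. L. Montgomery, Progr. Math. 70 (1987), §3 Lemma 8 — the uniform
  form of Montgomery's theorem on `[0, 1]` used through `MontgomeryTheoremGoldstonMontgomery.lean`.
* [BaluyotGoldstonSuriajayaTurnageButterbaugh2025] arXiv:2508.10857, §2 (MT-Pairs, first display) and §5
  (K-Fejer) — the tree's pair-sum identity and Fejér pair.
-/

noncomputable section

open Filter Set MeasureTheory Real
open scoped Topology FourierTransform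

namespace Literature.NumberTheory.LFunctions

namespace MontgomerySmallGaps

/-! ## §N. "A little calculation reveals that `C(0.68) > 0`" -/

/-- From `f(0) = 0` and `f' ≥ 0` on `[0, ∞)` to `f ≥ 0` on `[0, ∞)`. [folklore] -/
private theorem nonneg_of_hasDerivAt {f f' : ℝ → ℝ} (hf : ∀ x, HasDerivAt f (f' x) x) (h0 : f 0 = 0)
    (hf' : ∀ x, 0 ≤ x → 0 ≤ f' x) {x : ℝ} (hx : 0 ≤ x) : 0 ≤ f x := by
  have hmono : MonotoneOn f (Ici 0) :=
    monotoneOn_of_deriv_nonneg (convex_Ici 0)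
      (fun y _ ↦ (hf y).continuousAt.continuousWithinAt)
      (fun y _ ↦ (hf y).differentiableAt.differentiableWithinAt)
      (fun y hy ↦ by
        rw [interior_Ici] at hy
        rw [(hf y).deriv]
        exact hf' y (le_of_lt hy))
  have := hmono (self_mem_Ici (a := (0 : ℝ))) hx hx
  rwa [h0] at this

/-- `x − x³/6 ≤ sin x` for `x ≥ 0`. [folklore] -/
private theorem sin_ge_three {x : ℝ} (hx : 0 ≤ x) : x - x ^ 3 / 6 ≤ sin x := by
  have key := nonneg_of_hasDerivAt (f := fun x ↦ sin x - (x - x ^ 3 / 6))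
    (f' := fun x ↦ cos x - (1 - x ^ 2 / 2)) ?_ (by simp) ?_ hx
  · linarith
  · intro y
    have h := (hasDerivAt_sin y).fun_sub
      ((hasDerivAt_id' y).fun_sub ((hasDerivAt_pow 3 y).div_const 6))
    refine h.congr_deriv ?_
    norm_num; ring
  · intro y _
    have := one_sub_sq_div_two_le_cos (x := y)
    linarith

/-- `cos x ≤ 1 − x²/2 + x⁴/24` for `x ≥ 0`. [folklore] -/
private theorem cos_le_four {x : ℝ} (hx : 0 ≤ x) : cos x ≤ 1 - x ^ 2 / 2 + x ^ 4 / 24 := by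
  have key := nonneg_of_hasDerivAt (f := fun x ↦ 1 - x ^ 2 / 2 + x ^ 4 / 24 - cos x)
    (f' := fun x ↦ sin x - (x - x ^ 3 / 6)) ?_ (by simp) ?_ hx
  · linarith
  · intro y
    have h := ((((hasDerivAt_const y (1:ℝ)).fun_sub ((hasDerivAt_pow 2 y).div_const 2)).fun_add
      ((hasDerivAt_pow 4 y).div_const 24)).fun_sub (hasDerivAt_cos y))
    refine h.congr_deriv ?_
    norm_num; ring
  · intro y hy
    have := sin_ge_three hy
    linarith

/-- `sin x ≤ x − x³/6 + x⁵/120` for `x ≥ 0`. [folklore] -/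
private theorem sin_le_five {x : ℝ} (hx : 0 ≤ x) : sin x ≤ x - x ^ 3 / 6 + x ^ 5 / 120 := by
  have key := nonneg_of_hasDerivAt (f := fun x ↦ x - x ^ 3 / 6 + x ^ 5 / 120 - sin x)
    (f' := fun x ↦ 1 - x ^ 2 / 2 + x ^ 4 / 24 - cos x) ?_ (by simp) ?_ hx
  · linarith
  · intro y
    have h := ((((hasDerivAt_id' y).fun_sub ((hasDerivAt_pow 3 y).div_const 6)).fun_add
      ((hasDerivAt_pow 5 y).div_const 120)).fun_sub (hasDerivAt_sin y))
    refine h.congr_deriv ?_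
    norm_num; ring
  · intro y hy
    have := cos_le_four hy
    linarith

/-- `1 − x²/2 + x⁴/24 − x⁶/720 ≤ cos x` for `x ≥ 0`. [folklore] -/
private theorem cos_ge_six {x : ℝ} (hx : 0 ≤ x) :
    1 - x ^ 2 / 2 + x ^ 4 / 24 - x ^ 6 / 720 ≤ cos x := by
  have key := nonneg_of_hasDerivAt
    (f := fun x ↦ cos x - (1 - x ^ 2 / 2 + x ^ 4 / 24 - x ^ 6 / 720))
    (f' := fun x ↦ x - x ^ 3 / 6 + x ^ 5 / 120 - sin x) ?_ (by simp) ?_ hx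
  · linarith
  · intro y
    have h := (hasDerivAt_cos y).fun_sub (((((hasDerivAt_const y (1:ℝ)).fun_sub
      ((hasDerivAt_pow 2 y).div_const 2)).fun_add ((hasDerivAt_pow 4 y).div_const 24)).fun_sub
      ((hasDerivAt_pow 6 y).div_const 720)))
    refine h.congr_deriv ?_
    norm_num; ring
  · intro y hy
    have := sin_le_five hy
    linarith

/-- `x − x³/6 + x⁵/120 − x⁷/5040 ≤ sin x` for `x ≥ 0`. [folklore] -/
private theorem sin_ge_seven {x : ℝ} (hx : 0 ≤ x) :
    x - x ^ 3 / 6 + x ^ 5 / 120 - x ^ 7 / 5040 ≤ sin x := by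
  have key := nonneg_of_hasDerivAt
    (f := fun x ↦ sin x - (x - x ^ 3 / 6 + x ^ 5 / 120 - x ^ 7 / 5040))
    (f' := fun x ↦ cos x - (1 - x ^ 2 / 2 + x ^ 4 / 24 - x ^ 6 / 720)) ?_ (by simp) ?_ hx
  · linarith
  · intro y
    have h := (hasDerivAt_sin y).fun_sub (((((hasDerivAt_id' y).fun_sub
      ((hasDerivAt_pow 3 y).div_const 6)).fun_add ((hasDerivAt_pow 5 y).div_const 120)).fun_sub
      ((hasDerivAt_pow 7 y).div_const 5040)))
    refine h.congr_deriv ?_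
    norm_num; ring
  · intro y hy
    have := cos_ge_six hy
    linarith

/-- The global Taylor bound `cos x ≤ 1 − x²/2! + x⁴/4! − x⁶/6! + x⁸/8!` (`x ≥ 0`; by evenness for all `x`). [folklore] -/
private theorem cos_le_eight {x : ℝ} (hx : 0 ≤ x) :
    cos x ≤ 1 - x ^ 2 / 2 + x ^ 4 / 24 - x ^ 6 / 720 + x ^ 8 / 40320 := by
  have key := nonneg_of_hasDerivAt
    (f := fun x ↦ 1 - x ^ 2 / 2 + x ^ 4 / 24 - x ^ 6 / 720 + x ^ 8 / 40320 - cos x)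
    (f' := fun x ↦ sin x - (x - x ^ 3 / 6 + x ^ 5 / 120 - x ^ 7 / 5040)) ?_ (by simp) ?_ hx
  · linarith
  · intro y
    have h := ((((((hasDerivAt_const y (1:ℝ)).fun_sub ((hasDerivAt_pow 2 y).div_const 2)).fun_add
      ((hasDerivAt_pow 4 y).div_const 24)).fun_sub ((hasDerivAt_pow 6 y).div_const 720)).fun_add
      ((hasDerivAt_pow 8 y).div_const 40320)).fun_sub (hasDerivAt_cos y))
    refine h.congr_deriv ?_
    norm_num; ring
  · intro y hy
    have := sin_ge_seven hy
    linarith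

/-- `sin² x ≥ x² − x⁴/3 + 2x⁶/45 − x⁸/315` for all real `x`. [folklore] -/
private theorem sin_sq_ge (x : ℝ) :
    x ^ 2 - x ^ 4 / 3 + 2 * x ^ 6 / 45 - x ^ 8 / 315 ≤ sin x ^ 2 := by
  wlog hx : 0 ≤ x generalizing x
  · have h := this (-x) (by linarith)
    rw [sin_neg, neg_sq] at h
    have e : (-x) ^ 2 - (-x) ^ 4 / 3 + 2 * (-x) ^ 6 / 45 - (-x) ^ 8 / 315 =
        x ^ 2 - x ^ 4 / 3 + 2 * x ^ 6 / 45 - x ^ 8 / 315 := by ring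
    linarith
  rw [sin_sq_eq_half_sub]
  have h := cos_le_eight (x := 2 * x) (by linarith)
  have e1 : (2 * x) ^ 2 = 4 * x ^ 2 := by ring
  have e2 : (2 * x) ^ 4 = 16 * x ^ 4 := by ring
  have e3 : (2 * x) ^ 6 = 64 * x ^ 6 := by ring
  have e4 : (2 * x) ^ 8 = 256 * x ^ 8 := by ring
  rw [e1, e2, e3, e4] at h
  linarith

/-- `a sinc²(c a) ≥ a − c²a³/3 + 2c⁴a⁵/45 − c⁶a⁷/315` for `a ≥ 0`. [folklore] -/
private theorem mul_sinc_sq_ge {a : ℝ} (ha : 0 ≤ a) (c : ℝ) :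
    a - c ^ 2 * a ^ 3 / 3 + 2 * c ^ 4 * a ^ 5 / 45 - c ^ 6 * a ^ 7 / 315 ≤
      a * sinc (c * a) ^ 2 := by
  rcases eq_or_ne c 0 with hc | hc
  · subst hc; simp
  rcases ha.eq_or_lt with ha0 | ha0
  · subst ha0; simp
  have h0 : c * a ≠ 0 := mul_ne_zero hc ha0.ne'
  rw [sinc_of_ne_zero h0, div_pow]
  have key := sin_sq_ge (c * a)
  rw [show a * (sin (c * a) ^ 2 / (c * a) ^ 2) = sin (c * a) ^ 2 * (a / (c * a) ^ 2) by ring]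
  have h2 : a - c ^ 2 * a ^ 3 / 3 + 2 * c ^ 4 * a ^ 5 / 45 - c ^ 6 * a ^ 7 / 315 =
      ((c * a) ^ 2 - (c * a) ^ 4 / 3 + 2 * (c * a) ^ 6 / 45 - (c * a) ^ 8 / 315) *
        (a / (c * a) ^ 2) := by
    field_simp
  rw [h2]
  exact mul_le_mul_of_nonneg_right key (by positivity)

/-- `∫_0^1 (a − c²a³/3 + 2c⁴a⁵/45 − c⁶a⁷/315) da = 1/2 − c²/12 + c⁴/135 − c⁶/2520`. [folklore] -/
private theorem integral_poly (c : ℝ) :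
    ∫ a in (0:ℝ)..1, (a - c ^ 2 * a ^ 3 / 3 + 2 * c ^ 4 * a ^ 5 / 45 - c ^ 6 * a ^ 7 / 315) =
      1 / 2 - c ^ 2 / 12 + c ^ 4 / 135 - c ^ 6 / 2520 := by
  have hd : ∀ a : ℝ, HasDerivAt (fun a : ℝ ↦ a ^ 2 / 2 - c ^ 2 * a ^ 4 / 12
      + 2 * c ^ 4 * a ^ 6 / 270 - c ^ 6 * a ^ 8 / 2520)
      (a - c ^ 2 * a ^ 3 / 3 + 2 * c ^ 4 * a ^ 5 / 45 - c ^ 6 * a ^ 7 / 315) a := by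
    intro a
    have h := ((((hasDerivAt_pow 2 a).div_const 2).fun_sub
      (((hasDerivAt_pow 4 a).const_mul (c ^ 2)).div_const 12)).fun_add
      (((hasDerivAt_pow 6 a).const_mul (2 * c ^ 4)).div_const 270)).fun_sub
      (((hasDerivAt_pow 8 a).const_mul (c ^ 6)).div_const 2520)
    refine h.congr_deriv ?_
    norm_num; ring
  rw [intervalIntegral.integral_eq_sub_of_hasDerivAt (fun a _ ↦ hd a)
    ((by fun_prop : Continuous fun a : ℝ ↦ a - c ^ 2 * a ^ 3 / 3 + 2 * c ^ 4 * a ^ 5 / 45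
      - c ^ 6 * a ^ 7 / 315).intervalIntegrable _ _)]
  ring

/-- **"A little calculation reveals that `C(0.68) > 0`"** (Montgomery 1973, §4), in the normalised form used
below: `1 < 0.68 · (1 + 2∫_0^1 α (sin(0.68πα)/(0.68πα))² dα)`, i.e. `C(0.68)/0.68 > 0` with
`C(λ) = λ + 2λ∫_0^1 α (sin πλα/πλα)² dα − 1 = λ + (1/π²λ) Cin(2πλ) − 1`. Proof: the integrand is bounded
below by `α − c²α³/3 + 2c⁴α⁵/45 − c⁶α⁷/315`, `c = 0.68π` (from `cos u ≤ 1 − u²/2 + u⁴/24 − u⁶/720 + u⁸/8!`),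
the polynomial is integrated exactly, and `3.141592 < π < 3.141593`. [cite: Montgomery1973, §4 (proof of Corollary 3, "C(0.68) > 0")] -/
theorem criterion_068 :
    1 < 0.68 * (1 + 2 * ∫ a in (0:ℝ)..1, a * sinc (π * 0.68 * a) ^ 2) := by
  set c : ℝ := π * 0.68 with hc
  have hmono : ∫ a in (0:ℝ)..1, (a - c ^ 2 * a ^ 3 / 3 + 2 * c ^ 4 * a ^ 5 / 45
      - c ^ 6 * a ^ 7 / 315) ≤ ∫ a in (0:ℝ)..1, a * sinc (c * a) ^ 2 := by
    refine intervalIntegral.integral_mono_on zero_le_one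
      ((by fun_prop : Continuous fun a : ℝ ↦ a - c ^ 2 * a ^ 3 / 3 + 2 * c ^ 4 * a ^ 5 / 45
        - c ^ 6 * a ^ 7 / 315).intervalIntegrable _ _)
      ((by fun_prop : Continuous fun a : ℝ ↦ a * sinc (c * a) ^ 2).intervalIntegrable _ _)
      fun a ha ↦ mul_sinc_sq_ge ha.1 c
  rw [integral_poly] at hmono
  have hpi1 := pi_gt_d6
  have hpi2 := pi_lt_d6
  have hc1 : 3.141592 * 0.68 < c := by rw [hc]; nlinarith
  have hc2 : c < 3.141593 * 0.68 := by rw [hc]; nlinarith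
  have hc0 : 0 < c := by linarith
  have h2u : c ^ 2 < (3.141593 * 0.68) ^ 2 := by gcongr
  have h4l : (3.141592 * 0.68) ^ 4 < c ^ 4 := by gcongr
  have h6u : c ^ 6 < (3.141593 * 0.68) ^ 6 := by gcongr
  norm_num at h2u h4l h6u ⊢
  linarith

/-! ## §1. The test function `g(α) = (sin πλα/πλα)²` and the pair sum (3) -/

/-- `g = sinc²(πλ ·)` is integrable on `ℝ`. [folklore] -/
private theorem integrable_sinc_sq {lam : ℝ} (hlam : 0 < lam) :
    Integrable fun a : ℝ ↦ Real.sinc (π * lam * a) ^ 2 := by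
  have h := (WienerIkehara.integrable_fejer (l := π * lam) (by positivity)).const_mul
    (1 / (2 * (π * lam)))
  refine h.congr (Eventually.of_forall fun y ↦ ?_)
  have : 2 * (π * lam) ≠ 0 := by positivity
  field_simp

/-- `∫_{−1}^{1} |α| sinc²(πλα) dα = 2 ∫_0^1 α sinc²(πλα) dα` (the integrand is even). [folklore] -/
private theorem integral_abs_mul_sinc_sq (lam : ℝ) :
    ∫ a in (-1:ℝ)..1, |a| * Real.sinc (π * lam * a) ^ 2 =
      2 * ∫ a in (0:ℝ)..1, a * Real.sinc (π * lam * a) ^ 2 := by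
  have hc : Continuous fun a : ℝ ↦ |a| * Real.sinc (π * lam * a) ^ 2 := by fun_prop
  rw [← intervalIntegral.integral_add_adjacent_intervals (b := 0) (hc.intervalIntegrable _ _)
    (hc.intervalIntegrable _ _)]
  have h1 : ∫ a in (-1:ℝ)..0, |a| * Real.sinc (π * lam * a) ^ 2 =
      ∫ a in (0:ℝ)..1, a * Real.sinc (π * lam * a) ^ 2 := by
    have hneg : ∫ a in (-1:ℝ)..0, |a| * Real.sinc (π * lam * a) ^ 2 =
        ∫ a in (-1:ℝ)..0, (fun b : ℝ ↦ |b| * Real.sinc (π * lam * b) ^ 2) (-a) := by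
      refine intervalIntegral.integral_congr fun a _ ↦ ?_
      simp only [abs_neg]
      rw [show π * lam * -a = -(π * lam * a) by ring, Real.sinc_neg]
    rw [hneg, intervalIntegral.integral_comp_neg (fun b : ℝ ↦ |b| * Real.sinc (π * lam * b) ^ 2)]
    simp only [neg_zero, neg_neg]
    refine intervalIntegral.integral_congr fun a ha ↦ ?_
    rw [uIcc_of_le zero_le_one] at ha
    simp only [abs_of_nonneg ha.1]
  have h2 : ∫ a in (0:ℝ)..1, |a| * Real.sinc (π * lam * a) ^ 2 =
      ∫ a in (0:ℝ)..1, a * Real.sinc (π * lam * a) ^ 2 := by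
    refine intervalIntegral.integral_congr fun a ha ↦ ?_
    rw [uIcc_of_le zero_le_one] at ha
    simp only [abs_of_nonneg ha.1]
  rw [h1, h2]
  ring

/-- **Montgomery's (3) for the Fejér pair** `r(u) = λ · λ⁻² max(λ − |u|, 0)`, `r̂(α) = λ (sin πλα/πλα)²`,
divided by `λ`: for `λ > 0` and `T > 1`,
`∑_{0<γ,γ'≤T} λ⁻² max(λ − |(γ−γ') log T/2π|, 0) · w(γ − γ') = ((T/2π) log T) ∫_ℝ F(α, T) (sin πλα/πλα)² dα`
(pairs of indices in `zeroIndexSet T`, with multiplicity; unconditional — the tree's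
`AH.sum_fourier_pairSpacing_eq_integral` with the Fourier pair `fourier_sinc_sq`).
[cite: Montgomery1973, §1 (3) and §4 (proof of Corollary 3, "We take r(u) = max(1−(|u|/λ), 0) in (3)")] -/
theorem sum_fejerTest_pairSpacing_eq {lam : ℝ} (hlam : 0 < lam) {T : ℝ} (hT : 1 < T) :
    ∑ p ∈ zeroIndexSet T ×ˢ zeroIndexSet T,
        AH.fejerTest lam 0 (AH.pairSpacing T p) * montgomeryWeight (zetaOrdinate p.1 - zetaOrdinate p.2) =
      T / (2 * π) * Real.log T * ∫ a, montgomeryFormFactor a T * Real.sinc (π * lam * a) ^ 2 := by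
  have hid := AH.sum_fourier_pairSpacing_eq_integral (fun a : ℝ ↦ Real.sinc (π * lam * a) ^ 2)
    (integrable_sinc_sq hlam) hT
  have hF : ∀ p : ℕ × ℕ, 𝓕 (fun a : ℝ ↦ ((Real.sinc (π * lam * a) ^ 2 : ℝ) : ℂ)) (AH.pairSpacing T p) =
      (AH.fejerTest lam 0 (AH.pairSpacing T p) : ℂ) := fun p ↦ fourier_sinc_sq hlam _
  simp_rw [hF] at hid
  exact_mod_cast hid

/-- The pair sum is at most `λ⁻¹` times the number of index pairs at normalised distance `< λ`
(`0 ≤ λ⁻² max(λ − |u|, 0) ≤ λ⁻¹ 𝟙_{|u|<λ}`, `0 < w ≤ 1`). [folklore] -/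
private theorem sum_fejerTest_le_card {lam : ℝ} (hlam : 0 < lam) (T : ℝ) :
    ∑ p ∈ zeroIndexSet T ×ˢ zeroIndexSet T,
        AH.fejerTest lam 0 (AH.pairSpacing T p) * montgomeryWeight (zetaOrdinate p.1 - zetaOrdinate p.2) ≤
      lam⁻¹ * (((zeroIndexSet T ×ˢ zeroIndexSet T).filter
        fun p ↦ |AH.pairSpacing T p| < lam).card : ℝ) := by
  have hterm : ∀ p ∈ zeroIndexSet T ×ˢ zeroIndexSet T,
      AH.fejerTest lam 0 (AH.pairSpacing T p) * montgomeryWeight (zetaOrdinate p.1 - zetaOrdinate p.2) ≤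
        if |AH.pairSpacing T p| < lam then lam⁻¹ else 0 := by
    intro p _
    split_ifs with hp
    · calc AH.fejerTest lam 0 (AH.pairSpacing T p) *
            montgomeryWeight (zetaOrdinate p.1 - zetaOrdinate p.2) ≤ lam⁻¹ * 1 :=
            mul_le_mul (AH.fejerTest_le hlam _ _) (montgomeryWeight_le_one _)
              (montgomeryWeight_pos _).le (inv_nonneg.mpr hlam.le)
        _ = lam⁻¹ := mul_one _
    · push Not at hp
      rw [AH.fejerTest_eq_zero (by rwa [sub_zero]), zero_mul]
  refine (Finset.sum_le_sum hterm).trans ?_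
  rw [Finset.sum_ite, Finset.sum_const_zero, add_zero, Finset.sum_const, nsmul_eq_mul, mul_comm]

/-! ## §2. "All but finitely many zeros": close pairs force small indices -/

/-- If `δ_n ≥ λ` for all `n ≥ M`, then an index pair `j < i` with `γ_i ≤ T` and
`|γ_i − γ_j| log T/2π < λ` has `i ≤ M`: otherwise `λ ≤ δ_{i−1} ≤ (γ_i − γ_{i−1}) log T/2π ≤ (γ_i − γ_j) log T/2π`. [folklore] -/
private theorem fst_le_of_pairSpacing_lt {lam : ℝ} {M : ℕ} (hM : ∀ n, M ≤ n → lam ≤ zetaNormalizedGap n)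
    {T : ℝ} {i j : ℕ} (hi : i ∈ zeroIndexSet T) (hji : j < i)
    (hclose : |AH.pairSpacing T (i, j)| < lam) : i ≤ M := by
  by_contra hcon
  push Not at hcon
  obtain ⟨n, rfl⟩ : ∃ n, i = n + 1 := ⟨i - 1, by omega⟩
  have hn : M ≤ n := by omega
  have hjn : j ≤ n := by omega
  have hmono : Monotone zetaOrdinate := zetaOrdinate_mono_holds
  have h14 : (14 : ℝ) < zetaOrdinate 0 := fourteen_lt_zetaOrdinate_zero_holds
  have hmem : mem_zeroIndexSet_iff := mem_zeroIndexSet_iff_holds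
  have hT : zetaOrdinate (n + 1) ≤ T := hmem.1 hi
  have h0n : zetaOrdinate 0 ≤ zetaOrdinate n := hmono (Nat.zero_le n)
  have hn1 : zetaOrdinate n ≤ zetaOrdinate (n + 1) := hmono (Nat.le_succ n)
  have hjn' : zetaOrdinate j ≤ zetaOrdinate n := hmono hjn
  have hpos : 0 < zetaOrdinate n := by linarith
  have hlog0 : 0 < Real.log (zetaOrdinate n) := Real.log_pos (by linarith)
  have hlogT : Real.log (zetaOrdinate n) ≤ Real.log T := Real.log_le_log hpos (hn1.trans hT)
  have hδ := hM n hn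
  rw [zetaNormalizedGap_eq_mul_div] at hδ
  have hps : AH.pairSpacing T (n + 1, j) =
      (zetaOrdinate (n + 1) - zetaOrdinate j) * Real.log T / (2 * π) := rfl
  have hle : (zetaOrdinate (n + 1) - zetaOrdinate n) * Real.log (zetaOrdinate n) ≤
      (zetaOrdinate (n + 1) - zetaOrdinate j) * Real.log T :=
    mul_le_mul (by linarith) hlogT hlog0.le (by linarith)
  have hlt : AH.pairSpacing T (n + 1, j) < lam := (le_abs_self _).trans_lt hclose
  rw [hps] at hlt
  have h2π : (0 : ℝ) < 2 * π := by positivity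
  have := (div_le_div_of_nonneg_right hle h2π.le)
  linarith

/-- Under "`δ_n ≥ λ` for `n ≥ M`", every index pair at normalised distance `< λ` is diagonal or has both
indices `≤ M`. [folklore] -/
private theorem close_pairs_subset {lam : ℝ} {M : ℕ} (hM : ∀ n, M ≤ n → lam ≤ zetaNormalizedGap n) (T : ℝ) :
    ((zeroIndexSet T ×ˢ zeroIndexSet T).filter fun p ↦ |AH.pairSpacing T p| < lam) ⊆
      (zeroIndexSet T).diag ∪ Finset.range (M + 1) ×ˢ Finset.range (M + 1) := by
  intro p hp
  rw [Finset.mem_filter, Finset.mem_product] at hp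
  obtain ⟨⟨hp1, hp2⟩, hclose⟩ := hp
  rw [Finset.mem_union]
  rcases eq_or_ne p.1 p.2 with heq | hne
  · exact Or.inl (Finset.mem_diag.2 ⟨hp1, heq⟩)
  · right
    rw [Finset.mem_product, Finset.mem_range, Finset.mem_range]
    rcases lt_or_gt_of_ne hne with hlt | hgt
    · -- `p.1 < p.2`: apply the lemma to the swapped pair
      have hclose' : |AH.pairSpacing T (p.2, p.1)| < lam := by
        have : AH.pairSpacing T (p.2, p.1) = -AH.pairSpacing T p := AH.pairSpacing_swap T p
        rw [this, abs_neg]; exact hclose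
      have h2 := fst_le_of_pairSpacing_lt hM hp2 hlt hclose'
      exact ⟨by omega, by omega⟩
    · have h1 := fst_le_of_pairSpacing_lt hM hp1 hgt hclose
      exact ⟨by omega, by omega⟩

/-- Hence the number of index pairs at normalised distance `< λ` is at most `N(T) + (M+1)²`. [folklore] -/
private theorem card_close_pairs_le {lam : ℝ} {M : ℕ} (hM : ∀ n, M ≤ n → lam ≤ zetaNormalizedGap n)
    (T : ℝ) :
    (((zeroIndexSet T ×ˢ zeroIndexSet T).filter fun p ↦ |AH.pairSpacing T p| < lam).card : ℝ) ≤
      zetaZeroCount T + ((M : ℝ) + 1) ^ 2 := by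
  have h := Finset.card_le_card (close_pairs_subset hM T)
  have h2 := (Finset.card_union_le ((zeroIndexSet T).diag)
    (Finset.range (M + 1) ×ˢ Finset.range (M + 1)))
  rw [Finset.diag_card, card_zeroIndexSet, Finset.card_product, Finset.card_range] at h2
  have h3 : (((zeroIndexSet T ×ˢ zeroIndexSet T).filter fun p ↦ |AH.pairSpacing T p| < lam).card : ℝ)
      ≤ ((zetaZeroCount T + (M + 1) * (M + 1) : ℕ) : ℝ) := by exact_mod_cast h.trans h2
  refine h3.trans (le_of_eq ?_)
  push_cast
  ring

/-! ## §3. Montgomery's criterion and Corollary 3 -/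

/-- **Montgomery's criterion** (1973, §4: "To obtain (8) we show that `C(λ) > 0`"): assume RH; if `λ > 0`
satisfies `C(λ)/λ = (1 + 2∫_0^1 α (sin πλα/πλα)² dα) − 1/λ > 0`, i.e. `1 < λ(1 + 2∫_0^1 α sinc²(πλα) dα)`, then
`δ_n = (γ_{n+1} − γ_n)(log γ_n/2π) < λ` for infinitely many `n`. OURS (bookkeeping, not printed): the
printed step "all but finitely many zeros are simple" is run as the contradiction from "`δ_n ≥ λ` for all
`n ≥ M`", which covers the multiple-zero case (`δ_n = 0`) of the source's remark at once; the analytic inputs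
are exactly the printed ones. RH is the ANTECEDENT; nothing here bears on its truth.
[cite: Montgomery1973, §4 (proof of Corollary 3)] -/
theorem frequently_zetaNormalizedGap_lt (hRH : RiemannHypothesis) {lam : ℝ} (hlam : 0 < lam)
    (hC : 1 < lam * (1 + 2 * ∫ a in (0:ℝ)..1, a * Real.sinc (π * lam * a) ^ 2)) :
    ∃ᶠ n in atTop, zetaNormalizedGap n < lam := by
  by_contra hnot
  rw [not_frequently] at hnot
  obtain ⟨M, hM⟩ := eventually_atTop.1 hnot
  have hM' : ∀ n, M ≤ n → lam ≤ zetaNormalizedGap n := fun n hn ↦ not_lt.1 (hM n hn)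
  -- the test function and its constants
  set g : ℝ → ℝ := fun a ↦ Real.sinc (π * lam * a) ^ 2 with hg
  set J : ℝ := 2 * ∫ a in (0:ℝ)..1, a * Real.sinc (π * lam * a) ^ 2 with hJ
  have hκ : 0 < lam * (1 + J) - 1 := by linarith
  set ε : ℝ := (lam * (1 + J) - 1) / (2 * (lam + 1)) with hε_def
  have hε : 0 < ε := by positivity
  have hεκ : ε * (lam + 1) = (lam * (1 + J) - 1) / 2 := by
    rw [hε_def]; field_simp
  -- properties of `g`
  have hgc : Continuous g := by simp only [hg]; fun_prop
  have hg0 : ∀ a, 0 ≤ g a := fun a ↦ sq_nonneg _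
  have hg_zero : g 0 = 1 := by simp [hg]
  have hgi : Integrable g := integrable_sinc_sq hlam
  have hB : ∀ x ∈ Set.Icc (-1 : ℝ) 1, |g x| ≤ 1 := by
    intro x _
    simp only [hg]
    rw [abs_of_nonneg (sq_nonneg _), ← sq_abs]
    exact pow_le_one₀ (abs_nonneg _) (Real.abs_sinc_le_one _)
  have hLip : ∃ C δ : ℝ, 0 < δ ∧ ∀ x : ℝ, |x - 0| < δ → |g x - g 0| ≤ C * |x - 0| := by
    refine ⟨(π * lam) ^ 2 / 3, 1, one_pos, fun x hx ↦ ?_⟩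
    rw [sub_zero] at hx ⊢
    rw [hg_zero]
    simp only [hg]
    have h1 : Real.sinc (π * lam * x) ^ 2 ≤ 1 := by
      rw [← sq_abs]; exact pow_le_one₀ (abs_nonneg _) (Real.abs_sinc_le_one _)
    have h2 := PairCorrelationSmallGaps.one_sub_sinc_sq_le (π * lam * x)
    rw [abs_of_nonpos (by linarith)]
    have hx2 : x ^ 2 ≤ |x| := by
      rw [← sq_abs]
      nlinarith [abs_nonneg x]
    calc -(Real.sinc (π * lam * x) ^ 2 - 1) = 1 - Real.sinc (π * lam * x) ^ 2 := by ring
      _ ≤ (π * lam * x) ^ 2 / 3 := h2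
      _ = (π * lam) ^ 2 / 3 * x ^ 2 := by ring
      _ ≤ (π * lam) ^ 2 / 3 * |x| := by gcongr
  -- (e1) Montgomery's theorem on `[−1, 1]`: `∫_{−1}^{1} F g > 1 + J − ε` for large `T`
  have hlim := Montgomery.tendsto_integral_formFactor_mul_of_subset_Icc hRH (a := -1) (b := 1) (g := g)
    (by norm_num) le_rfl le_rfl (hgc.intervalIntegrable _ _) hB hLip
  have hJ' : ∫ a in (-1:ℝ)..1, |a| * g a = J := by
    simp only [hg, hJ]
    exact integral_abs_mul_sinc_sq lam
  rw [hJ', hg_zero, if_pos (show (-1:ℝ) < 0 ∧ (0:ℝ) ≤ 1 by norm_num),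
    if_pos (show (-1:ℝ) ≤ 0 ∧ (0:ℝ) < 1 by norm_num)] at hlim
  have e1 : ∀ᶠ T : ℝ in atTop, 1 + J - ε < ∫ a in (-1:ℝ)..1, montgomeryFormFactor a T * g a := by
    filter_upwards [hlim.eventually_const_lt (show -ε < 0 by linarith)] with T hT
    linarith
  -- (e2) Riemann–von Mangoldt: `N(T) < (1 + ε) (T/2π) log T` for large `T`
  have e2 : ∀ᶠ T : ℝ in atTop,
      (zetaZeroCount T : ℝ) / (T / (2 * π) * Real.log T) < 1 + ε :=
    RudnickSarnak.tendsto_zetaZeroCount_div_main.eventually_lt_const (by linarith)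
  -- (e4) `(T/2π) log T → ∞`
  have hX : Tendsto (fun T : ℝ ↦ T / (2 * π) * Real.log T) atTop atTop :=
    (tendsto_id.atTop_div_const (by positivity)).atTop_mul_atTop₀ Real.tendsto_log_atTop
  have e4 := hX.eventually_gt_atTop (((M : ℝ) + 1) ^ 2 / ((lam * (1 + J) - 1) / 2))
  obtain ⟨T, h1, h2, hT1, h4⟩ := (e1.and (e2.and ((eventually_gt_atTop (1 : ℝ)).and e4))).exists
  -- at this `T`
  have hT0 : 0 < T := by linarith
  have hlog : 0 < Real.log T := Real.log_pos hT1
  set X : ℝ := T / (2 * π) * Real.log T with hXdef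
  have hXpos : 0 < X := by positivity
  have hN : (zetaZeroCount T : ℝ) < (1 + ε) * X := by
    have := (div_lt_iff₀ hXpos).1 h2
    linarith
  -- the pair sum `S`
  set S : ℝ := ∑ p ∈ zeroIndexSet T ×ˢ zeroIndexSet T,
    AH.fejerTest lam 0 (AH.pairSpacing T p) * montgomeryWeight (zetaOrdinate p.1 - zetaOrdinate p.2)
    with hSdef
  have hS_eq : S = X * ∫ a, montgomeryFormFactor a T * g a := sum_fejerTest_pairSpacing_eq hlam hT1
  -- lower bound for `S`
  have hF0 : ∀ a, 0 ≤ montgomeryFormFactor a T := fun a ↦ Montgomery.montgomeryFormFactor_nonneg a hT1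
  have hFc : Continuous fun a ↦ montgomeryFormFactor a T := RudnickSarnak.continuous_montgomeryFormFactor T
  have hFg_int : Integrable fun a ↦ montgomeryFormFactor a T * g a := by
    refine hgi.bdd_mul (c := |2 * π / (T * Real.log T)| *
      ((zeroIndexSet T ×ˢ zeroIndexSet T).card : ℝ)) hFc.aestronglyMeasurable
      (Eventually.of_forall fun a ↦ ?_)
    rw [Real.norm_eq_abs]
    exact abs_montgomeryFormFactor_le a T
  have hlow : ∫ a in (-1:ℝ)..1, montgomeryFormFactor a T * g a ≤ ∫ a, montgomeryFormFactor a T * g a := by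
    rw [intervalIntegral.integral_of_le (by norm_num : (-1:ℝ) ≤ 1)]
    exact setIntegral_le_integral hFg_int (Eventually.of_forall fun a ↦ mul_nonneg (hF0 a) (hg0 a))
  have hS_low : X * (1 + J - ε) < S := by
    rw [hS_eq]
    exact mul_lt_mul_of_pos_left (h1.trans_le hlow) hXpos
  -- upper bound for `S`
  have hS_up : S ≤ lam⁻¹ * ((zetaZeroCount T : ℝ) + ((M : ℝ) + 1) ^ 2) :=
    (sum_fejerTest_le_card hlam T).trans
      (mul_le_mul_of_nonneg_left (card_close_pairs_le hM' T) (inv_nonneg.mpr hlam.le))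
  -- contradiction
  have hcomb : lam * (X * (1 + J - ε)) < (1 + ε) * X + ((M : ℝ) + 1) ^ 2 := by
    have h := hS_low.trans_le hS_up
    have h' := mul_lt_mul_of_pos_left h hlam
    have hY : lam * (lam⁻¹ * ((zetaZeroCount T : ℝ) + ((M : ℝ) + 1) ^ 2)) =
        (zetaZeroCount T : ℝ) + ((M : ℝ) + 1) ^ 2 := by
      field_simp
    linarith
  have hεX : X * (ε * (lam + 1)) = X * ((lam * (1 + J) - 1) / 2) := by rw [hεκ]
  have h4' : ((M : ℝ) + 1) ^ 2 < X * ((lam * (1 + J) - 1) / 2) := by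
    rwa [div_lt_iff₀ (by positivity)] at h4
  linarith

/-- The "infinitely often" form actually reached by the proof: on RH, `δ_n < 0.68` for infinitely many `n`
(`frequently_zetaNormalizedGap_lt` at `λ = 0.68`, `criterion_068`). RH is the ANTECEDENT; nothing here bears
on its truth. [cite: Montgomery1973, Corollary 3 and §4 (proof of Corollary 3)] -/
theorem frequently_zetaNormalizedGap_lt_068 (hRH : RiemannHypothesis) :
    ∃ᶠ n in atTop, zetaNormalizedGap n < 0.68 :=
  frequently_zetaNormalizedGap_lt hRH (by norm_num) criterion_068

end MontgomerySmallGaps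

/-- **DISCHARGE of `Literature.NumberTheory.LFunctions.montgomery1973_corollary3`** (Montgomery 1973,
Corollary 3 with (8) and "Our proof allows us to take `λ = 0.68`"): assuming RH,
`lim inf_{n→∞} (γ_{n+1} − γ_n)(log γ_n/2π) ≤ 0.68`, as the tree's `ZetaGapLiminfLe 0.68`. From
`MontgomerySmallGaps.frequently_zetaNormalizedGap_lt_068` and `zetaGapLiminfLe_of_frequently_lt`
(`ZetaGapRecordsRH.lean`). RH is the ANTECEDENT; nothing here bears on its truth.
[cite: Montgomery1973, Corollary 3 with eq. (8) and λ = 0.68, pp. 181–182; §4 (proof)] -/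
theorem montgomery1973_corollary3_holds :
    Literature.NumberTheory.LFunctions.montgomery1973_corollary3 := fun hRH ↦
  zetaGapLiminfLe_of_frequently_lt (MontgomerySmallGaps.frequently_zetaNormalizedGap_lt_068 hRH)

/-- On RH, `μ = lim inf_n δ_n ≤ 0.68` for Mathlib's `Filter.liminf` of the normalised gaps (via the tree's
`zetaGapLiminfLe_iff`). [cite: Montgomery1973, Corollary 3 with eq. (8), p. 182] -/
theorem MontgomerySmallGaps.zetaGapLiminf_le_068 (hRH : RiemannHypothesis) : zetaGapLiminf ≤ 0.68 :=
  (zetaGapLiminfLe_iff _).1 (montgomery1973_corollary3_holds hRH)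

end Literature.NumberTheory.LFunctions

end
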